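import Summits.HodgeConjecture.CorCM.Model.AlgDuality
import Summits.HodgeConjecture.CorCM.Geometry.Facts
import Summits.HodgeConjecture.CorCM.Model.Universe
import HarnessLib

/-!
# COR-CM model layer, row M22: `Fact_algDuality` of `Model.universeOf`, modulo the R2 → P input (adjoint contract)

Cell `pub-hodgecm2` (COR-CM), seat b29 (K-a junction understudy, ROSTER RULING v3.3).  JUNCTION of the K-a assembly
(`CorCM/Model/AlgDuality.lean`: `exists_fourierSum_algDuality`, `var_algDuality`) with the stage-1 field
`ModelAxioms.algDuality` = `Universe.Fact_algDuality` (`CorCM/Geometry/Facts.lean` :251) for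
`U₀ = Model.universeOf hHD hI hU h₃` (`CorCM/Model/Universe.lean`).  Two declarations, def-free:

* `var_algDuality_adjoint` — `var_algDuality` with the Rosati input in the ADJOINT CONTRACT asked for by model-1
  (19:37:54Z): `Σ_a Ma^*(b_a) ⊗ y_a = Σ_a b_a ⊗ Mb^*(y_a)` for all `IsDiagAct` data `(a, Ma, da)`, `(ā, Mb, db)`
  (the form produced by the Rosati engine `RosatiTensor.sum_tmul_rosati_of_balanced` (b22) from the K-balanced
  algebraic polarisation of each coded realisation — lit-milne g5 p232481, lit-deligne g5, b13 `RosatiTheta` — and to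
  be assembled on the corner product by the R2 → P seat b26);
* `universeOf_fact_algDuality` — `(universeOf hHD hI hU h₃).Fact_algDuality` from
  `hR2P : ∀ K Φ, ∃ N (b y : bases of H¹(prod4 K Φ; ℚ)), halg ∧ hadj`, `IsDiagAct` destructured as in model-1's
  `universeOf_deg_diag`.

References: [Lieberman1968] D. Lieberman, Amer. J. Math. 90 (1968) 366–374; [Kleiman1968AlgebraicCycles] S. Kleiman
(1968) App. 2A; [MumfordAV1970] D. Mumford, *Abelian Varieties* §20 (Rosati involution).
-/

noncomputable section

open CategoryTheory MonoidalCategory CartesianMonoidalCategory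
open Literature.AlgebraicTopology.SingularHomology
open Literature.AlgebraicGeometry Literature.AlgebraicGeometry.Motives Literature.AlgebraicGeometry.HodgeTheory
open Literature.NumberTheory.Automorphic Literature.NumberTheory.Automorphic.PicardCM
open scoped TensorProduct

namespace Summit.HodgeConjecture.CorCM.Model

/-- **`Fact_algDuality` at the variety level, ADJOINT CONTRACT** (model-1 19:37:54Z): the same assembly as
`var_algDuality` (`CorCM/Model/AlgDuality.lean`), with the Rosati input taken in the form the R2 → P junction delivers —
the tensor identity `Σ_a Ma^*(b_a) ⊗ y_a = Σ_a b_a ⊗ Mb^*(y_a)` for every pair `(Ma, Mb)` of endomorphisms of `P` acting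
diagonally by `a`, `ā` (the unfolded `IsDiagAct` data of `Fact_algDuality`, spelled as in `var_deg_diag`).
[cite: Lieberman1968, Thm. 1] [cite: Kleiman1968AlgebraicCycles, §2 Appendix 2A] -/
theorem var_algDuality_adjoint (hHD : exists_isReal_hodgeModel) (hI : hodgePQ_independent_of_hodgeModel)
    (hU : BallQuotientUniformisedDatum) (h₃ : CMAbelianVarietyRealised) (c : Fin 4 → CMCode) {K : Type} [Field K]
    [NumberField K] [NumberField.IsCMField K] (e : (i : Fin 4) → (K ≃+* (c i).E)) {N : ℕ}
    (b y : Module.Basis (Fin N) ℚ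
      (Var.Coh hU h₃ (Var.prod (Var.prod (Var.prod (.cm (c 0)) (.cm (c 1))) (.cm (c 2))) (.cm (c 3))) 1))
    (halg : (∑ cc : Fin 4 → Fin N, bettiCup (two_mul 4).symm
        (BettiUniverse.pull
            (fst (Var.scheme hU h₃ (Var.prod (Var.prod (Var.prod (.cm (c 0)) (.cm (c 1))) (.cm (c 2))) (.cm (c 3))))
              (Var.scheme hU h₃ (Var.prod (Var.prod (Var.prod (.cm (c 0)) (.cm (c 1))) (.cm (c 2))) (.cm (c 3))))) 4
          (cupPowOne ℚ (ComplexPoints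
            (Var.scheme hU h₃ (Var.prod (Var.prod (Var.prod (.cm (c 0)) (.cm (c 1))) (.cm (c 2))) (.cm (c 3))))) 4
            (fun p ↦ b (cc p))))
        (BettiUniverse.pull
            (snd (Var.scheme hU h₃ (Var.prod (Var.prod (Var.prod (.cm (c 0)) (.cm (c 1))) (.cm (c 2))) (.cm (c 3))))
              (Var.scheme hU h₃ (Var.prod (Var.prod (Var.prod (.cm (c 0)) (.cm (c 1))) (.cm (c 2))) (.cm (c 3))))) 4
          (cupPowOne ℚ (ComplexPoints
            (Var.scheme hU h₃ (Var.prod (Var.prod (Var.prod (.cm (c 0)) (.cm (c 1))) (.cm (c 2))) (.cm (c 3))))) 4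
            (fun p ↦ y (cc p))))) ∈
      ratAlgebraicClasses
        (Var.scheme hU h₃ (Var.prod (Var.prod (Var.prod (.cm (c 0)) (.cm (c 1))) (.cm (c 2))) (.cm (c 3))) ⊗
          Var.scheme hU h₃ (Var.prod (Var.prod (Var.prod (.cm (c 0)) (.cm (c 1))) (.cm (c 2))) (.cm (c 3)))) 4)
    (hadj : ∀ (a : K)
        (Ma Mb : Var.Mor hU h₃ (Var.prod (Var.prod (Var.prod (.cm (c 0)) (.cm (c 1))) (.cm (c 2))) (.cm (c 3)))
          (Var.prod (Var.prod (Var.prod (.cm (c 0)) (.cm (c 1))) (.cm (c 2))) (.cm (c 3))))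
        (da db : (i : Fin 4) → Var.Mor hU h₃ (.cm (c i)) (.cm (c i))),
        (∀ i, BettiUniverse.pull (da i) 1 =
          (BettiUniverse.cmEndAction ((cmRealisation h₃ (c i)).θ.comp (e i).toRingHom)
            ((cmRealisation h₃ (c i)).exists_map_comp (e i)) hHD hI (Var.isSmoothProjective hU h₃ (.cm (c i)))).ι a) →
        (∀ k, BettiUniverse.pull Ma k ∘ₗ
            BettiUniverse.pull (Var.comp hU h₃ (Var.fst hU h₃ _ (.cm (c 3)))
              (Var.comp hU h₃ (Var.fst hU h₃ _ (.cm (c 2))) (Var.fst hU h₃ (.cm (c 0)) (.cm (c 1))))) k =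
          BettiUniverse.pull (Var.comp hU h₃ (Var.fst hU h₃ _ (.cm (c 3)))
              (Var.comp hU h₃ (Var.fst hU h₃ _ (.cm (c 2))) (Var.fst hU h₃ (.cm (c 0)) (.cm (c 1))))) k ∘ₗ
            BettiUniverse.pull (da 0) k) →
        (∀ k, BettiUniverse.pull Ma k ∘ₗ
            BettiUniverse.pull (Var.comp hU h₃ (Var.fst hU h₃ _ (.cm (c 3)))
              (Var.comp hU h₃ (Var.fst hU h₃ _ (.cm (c 2))) (Var.snd hU h₃ (.cm (c 0)) (.cm (c 1))))) k =
          BettiUniverse.pull (Var.comp hU h₃ (Var.fst hU h₃ _ (.cm (c 3)))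
              (Var.comp hU h₃ (Var.fst hU h₃ _ (.cm (c 2))) (Var.snd hU h₃ (.cm (c 0)) (.cm (c 1))))) k ∘ₗ
            BettiUniverse.pull (da 1) k) →
        (∀ k, BettiUniverse.pull Ma k ∘ₗ
            BettiUniverse.pull (Var.comp hU h₃ (Var.fst hU h₃ _ (.cm (c 3))) (Var.snd hU h₃ _ (.cm (c 2)))) k =
          BettiUniverse.pull (Var.comp hU h₃ (Var.fst hU h₃ _ (.cm (c 3))) (Var.snd hU h₃ _ (.cm (c 2)))) k ∘ₗ
            BettiUniverse.pull (da 2) k) →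
        (∀ k, BettiUniverse.pull Ma k ∘ₗ BettiUniverse.pull (Var.snd hU h₃ _ (.cm (c 3))) k =
          BettiUniverse.pull (Var.snd hU h₃ _ (.cm (c 3))) k ∘ₗ BettiUniverse.pull (da 3) k) →
        (∀ i, BettiUniverse.pull (db i) 1 =
          (BettiUniverse.cmEndAction ((cmRealisation h₃ (c i)).θ.comp (e i).toRingHom)
            ((cmRealisation h₃ (c i)).exists_map_comp (e i)) hHD hI (Var.isSmoothProjective hU h₃ (.cm (c i)))).ι
            (cmConjRingHom K a)) →
        (∀ k, BettiUniverse.pull Mb k ∘ₗ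
            BettiUniverse.pull (Var.comp hU h₃ (Var.fst hU h₃ _ (.cm (c 3)))
              (Var.comp hU h₃ (Var.fst hU h₃ _ (.cm (c 2))) (Var.fst hU h₃ (.cm (c 0)) (.cm (c 1))))) k =
          BettiUniverse.pull (Var.comp hU h₃ (Var.fst hU h₃ _ (.cm (c 3)))
              (Var.comp hU h₃ (Var.fst hU h₃ _ (.cm (c 2))) (Var.fst hU h₃ (.cm (c 0)) (.cm (c 1))))) k ∘ₗ
            BettiUniverse.pull (db 0) k) →
        (∀ k, BettiUniverse.pull Mb k ∘ₗ
            BettiUniverse.pull (Var.comp hU h₃ (Var.fst hU h₃ _ (.cm (c 3)))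
              (Var.comp hU h₃ (Var.fst hU h₃ _ (.cm (c 2))) (Var.snd hU h₃ (.cm (c 0)) (.cm (c 1))))) k =
          BettiUniverse.pull (Var.comp hU h₃ (Var.fst hU h₃ _ (.cm (c 3)))
              (Var.comp hU h₃ (Var.fst hU h₃ _ (.cm (c 2))) (Var.snd hU h₃ (.cm (c 0)) (.cm (c 1))))) k ∘ₗ
            BettiUniverse.pull (db 1) k) →
        (∀ k, BettiUniverse.pull Mb k ∘ₗ
            BettiUniverse.pull (Var.comp hU h₃ (Var.fst hU h₃ _ (.cm (c 3))) (Var.snd hU h₃ _ (.cm (c 2)))) k =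
          BettiUniverse.pull (Var.comp hU h₃ (Var.fst hU h₃ _ (.cm (c 3))) (Var.snd hU h₃ _ (.cm (c 2)))) k ∘ₗ
            BettiUniverse.pull (db 2) k) →
        (∀ k, BettiUniverse.pull Mb k ∘ₗ BettiUniverse.pull (Var.snd hU h₃ _ (.cm (c 3))) k =
          BettiUniverse.pull (Var.snd hU h₃ _ (.cm (c 3))) k ∘ₗ BettiUniverse.pull (db 3) k) →
        ∑ a', BettiUniverse.pull Ma 1 (b a') ⊗ₜ[ℚ] y a' = ∑ a', b a' ⊗ₜ[ℚ] BettiUniverse.pull Mb 1 (y a')) :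
    ∃ D : Var.Coh hU h₃ (Var.prod (Var.prod (Var.prod (.cm (c 0)) (.cm (c 1))) (.cm (c 2))) (.cm (c 3)))
          (2 * (Var.dim (Var.prod (Var.prod (Var.prod (.cm (c 0)) (.cm (c 1))) (.cm (c 2))) (.cm (c 3))) - 2)) →ₗ[ℚ]
        Var.Coh hU h₃ (Var.prod (Var.prod (Var.prod (.cm (c 0)) (.cm (c 1))) (.cm (c 2))) (.cm (c 3))) 4,
      Function.Bijective D ∧
      (Var.alg hU h₃ (Var.prod (Var.prod (Var.prod (.cm (c 0)) (.cm (c 1))) (.cm (c 2))) (.cm (c 3)))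
          (Var.dim (Var.prod (Var.prod (Var.prod (.cm (c 0)) (.cm (c 1))) (.cm (c 2))) (.cm (c 3))) - 2)).map D ≤
        Var.alg hU h₃ (Var.prod (Var.prod (Var.prod (.cm (c 0)) (.cm (c 1))) (.cm (c 2))) (.cm (c 3))) 2 ∧
      ∀ (a : K)
        (Ma Mb : Var.Mor hU h₃ (Var.prod (Var.prod (Var.prod (.cm (c 0)) (.cm (c 1))) (.cm (c 2))) (.cm (c 3)))
          (Var.prod (Var.prod (Var.prod (.cm (c 0)) (.cm (c 1))) (.cm (c 2))) (.cm (c 3))))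
        (da db : (i : Fin 4) → Var.Mor hU h₃ (.cm (c i)) (.cm (c i))),
        (∀ i, BettiUniverse.pull (da i) 1 =
          (BettiUniverse.cmEndAction ((cmRealisation h₃ (c i)).θ.comp (e i).toRingHom)
            ((cmRealisation h₃ (c i)).exists_map_comp (e i)) hHD hI (Var.isSmoothProjective hU h₃ (.cm (c i)))).ι a) →
        (∀ k, BettiUniverse.pull Ma k ∘ₗ
            BettiUniverse.pull (Var.comp hU h₃ (Var.fst hU h₃ _ (.cm (c 3)))
              (Var.comp hU h₃ (Var.fst hU h₃ _ (.cm (c 2))) (Var.fst hU h₃ (.cm (c 0)) (.cm (c 1))))) k =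
          BettiUniverse.pull (Var.comp hU h₃ (Var.fst hU h₃ _ (.cm (c 3)))
              (Var.comp hU h₃ (Var.fst hU h₃ _ (.cm (c 2))) (Var.fst hU h₃ (.cm (c 0)) (.cm (c 1))))) k ∘ₗ
            BettiUniverse.pull (da 0) k) →
        (∀ k, BettiUniverse.pull Ma k ∘ₗ
            BettiUniverse.pull (Var.comp hU h₃ (Var.fst hU h₃ _ (.cm (c 3)))
              (Var.comp hU h₃ (Var.fst hU h₃ _ (.cm (c 2))) (Var.snd hU h₃ (.cm (c 0)) (.cm (c 1))))) k =
          BettiUniverse.pull (Var.comp hU h₃ (Var.fst hU h₃ _ (.cm (c 3)))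
              (Var.comp hU h₃ (Var.fst hU h₃ _ (.cm (c 2))) (Var.snd hU h₃ (.cm (c 0)) (.cm (c 1))))) k ∘ₗ
            BettiUniverse.pull (da 1) k) →
        (∀ k, BettiUniverse.pull Ma k ∘ₗ
            BettiUniverse.pull (Var.comp hU h₃ (Var.fst hU h₃ _ (.cm (c 3))) (Var.snd hU h₃ _ (.cm (c 2)))) k =
          BettiUniverse.pull (Var.comp hU h₃ (Var.fst hU h₃ _ (.cm (c 3))) (Var.snd hU h₃ _ (.cm (c 2)))) k ∘ₗ
            BettiUniverse.pull (da 2) k) →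
        (∀ k, BettiUniverse.pull Ma k ∘ₗ BettiUniverse.pull (Var.snd hU h₃ _ (.cm (c 3))) k =
          BettiUniverse.pull (Var.snd hU h₃ _ (.cm (c 3))) k ∘ₗ BettiUniverse.pull (da 3) k) →
        (∀ i, BettiUniverse.pull (db i) 1 =
          (BettiUniverse.cmEndAction ((cmRealisation h₃ (c i)).θ.comp (e i).toRingHom)
            ((cmRealisation h₃ (c i)).exists_map_comp (e i)) hHD hI (Var.isSmoothProjective hU h₃ (.cm (c i)))).ι
            (cmConjRingHom K a)) →
        (∀ k, BettiUniverse.pull Mb k ∘ₗ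
            BettiUniverse.pull (Var.comp hU h₃ (Var.fst hU h₃ _ (.cm (c 3)))
              (Var.comp hU h₃ (Var.fst hU h₃ _ (.cm (c 2))) (Var.fst hU h₃ (.cm (c 0)) (.cm (c 1))))) k =
          BettiUniverse.pull (Var.comp hU h₃ (Var.fst hU h₃ _ (.cm (c 3)))
              (Var.comp hU h₃ (Var.fst hU h₃ _ (.cm (c 2))) (Var.fst hU h₃ (.cm (c 0)) (.cm (c 1))))) k ∘ₗ
            BettiUniverse.pull (db 0) k) →
        (∀ k, BettiUniverse.pull Mb k ∘ₗ
            BettiUniverse.pull (Var.comp hU h₃ (Var.fst hU h₃ _ (.cm (c 3)))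
              (Var.comp hU h₃ (Var.fst hU h₃ _ (.cm (c 2))) (Var.snd hU h₃ (.cm (c 0)) (.cm (c 1))))) k =
          BettiUniverse.pull (Var.comp hU h₃ (Var.fst hU h₃ _ (.cm (c 3)))
              (Var.comp hU h₃ (Var.fst hU h₃ _ (.cm (c 2))) (Var.snd hU h₃ (.cm (c 0)) (.cm (c 1))))) k ∘ₗ
            BettiUniverse.pull (db 1) k) →
        (∀ k, BettiUniverse.pull Mb k ∘ₗ
            BettiUniverse.pull (Var.comp hU h₃ (Var.fst hU h₃ _ (.cm (c 3))) (Var.snd hU h₃ _ (.cm (c 2)))) k =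
          BettiUniverse.pull (Var.comp hU h₃ (Var.fst hU h₃ _ (.cm (c 3))) (Var.snd hU h₃ _ (.cm (c 2)))) k ∘ₗ
            BettiUniverse.pull (db 2) k) →
        (∀ k, BettiUniverse.pull Mb k ∘ₗ BettiUniverse.pull (Var.snd hU h₃ _ (.cm (c 3))) k =
          BettiUniverse.pull (Var.snd hU h₃ _ (.cm (c 3))) k ∘ₗ BettiUniverse.pull (db 3) k) →
        BettiUniverse.pull Mb 4 ∘ₗ D ∘ₗ BettiUniverse.pull Ma
            (2 * (Var.dim (Var.prod (Var.prod (Var.prod (.cm (c 0)) (.cm (c 1))) (.cm (c 2))) (.cm (c 3))) - 2)) =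
          ((Algebra.norm ℚ a) ^ 4) • D := by
  classical
  -- the product abelian variety whose underlying scheme is the model's scheme of `P` (definitionally)
  let B : AbelianVariety ℂ :=
    (((cmRealisation h₃ (c 0)).AV.prod (cmRealisation h₃ (c 1)).AV).prod (cmRealisation h₃ (c 2)).AV).prod
      (cmRealisation h₃ (c 3)).AV
  have hP : IsSmoothProjective (Var.dim (Var.prod (Var.prod (Var.prod (.cm (c 0)) (.cm (c 1))) (.cm (c 2))) (.cm (c 3))))
      B.X :=
    Var.isSmoothProjective hU h₃ (Var.prod (Var.prod (Var.prod (.cm (c 0)) (.cm (c 1))) (.cm (c 2))) (.cm (c 3)))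
  have hd : 3 ≤ Var.dim (Var.prod (Var.prod (Var.prod (.cm (c 0)) (.cm (c 1))) (.cm (c 2))) (.cm (c 3))) := by
    have h0 := one_le_finrank_div_two (c 0)
    have h1 := one_le_finrank_div_two (c 1)
    have h2 := one_le_finrank_div_two (c 2)
    have h3 := one_le_finrank_div_two (c 3)
    change 3 ≤ Module.finrank ℚ (c 0).E / 2 + Module.finrank ℚ (c 1).E / 2 + Module.finrank ℚ (c 2).E / 2 +
      Module.finrank ℚ (c 3).E / 2
    omega
  obtain ⟨D, hD, hbij, hmap, hii, hii0⟩ := exists_fourierSum_algDuality B hP hd b y halg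
  refine ⟨D, hbij, hmap, ?_⟩
  intro a Ma Mb da db hda hMa₀ hMa₁ hMa₂ hMa₃ hdb hMb₀ hMb₁ hMb₂ hMb₃
  -- Künneth in degree one for the four factors
  haveI i0 : Module.Finite ℚ (bettiCohomology (Var.scheme hU h₃ (.cm (c 0))) 1) := Var.finite hU h₃ _ 1
  haveI i1 : Module.Finite ℚ (bettiCohomology (Var.scheme hU h₃ (.cm (c 1))) 1) := Var.finite hU h₃ _ 1
  haveI i2 : Module.Finite ℚ (bettiCohomology (Var.scheme hU h₃ (.cm (c 2))) 1) := Var.finite hU h₃ _ 1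
  haveI i3 : Module.Finite ℚ (bettiCohomology (Var.scheme hU h₃ (.cm (c 3))) 1) := Var.finite hU h₃ _ 1
  haveI iP : Module.Finite ℚ
      (Var.Coh hU h₃ (Var.prod (Var.prod (Var.prod (.cm (c 0)) (.cm (c 1))) (.cm (c 2))) (.cm (c 3))) 1) :=
    Var.finite hU h₃ (Var.prod (Var.prod (Var.prod (.cm (c 0)) (.cm (c 1))) (.cm (c 2))) (.cm (c 3))) 1
  have hΨ := kunneth_one_bijective₄ (Var.isSmoothProjective hU h₃ (.cm (c 0)))
    (Var.isSmoothProjective hU h₃ (.cm (c 1))) (Var.isSmoothProjective hU h₃ (.cm (c 2)))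
    (Var.isSmoothProjective hU h₃ (.cm (c 3)))
  by_cases ha : a = 0
  · -- `a = 0`: `Ma^* = 0` on `H¹`, both sides vanish
    subst ha
    have hda0 : ∀ i, BettiUniverse.pull (da i) 1 = 0 := fun i ↦ by rw [hda i]; exact map_zero _
    have hMa1 : BettiUniverse.pull Ma 1 = 0 :=
      eq_zero_of_comp_coprod₄ _ _ _ _ hΨ.2 (BettiUniverse.pull Ma 1)
        ((hMa₀ 1).trans (by rw [hda0 0, LinearMap.comp_zero])) ((hMa₁ 1).trans (by rw [hda0 1, LinearMap.comp_zero]))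
        ((hMa₂ 1).trans (by rw [hda0 2, LinearMap.comp_zero])) ((hMa₃ 1).trans (by rw [hda0 3, LinearMap.comp_zero]))
    rw [Algebra.norm_zero, zero_pow four_ne_zero, zero_smul]
    exact hii0 Ma Mb hMa1
  · -- `a ≠ 0`: `Ma^*` is an automorphism of `H¹` of determinant `N(a)⁴ ≠ 0`
    have hτ := var_deg_diag hHD hI hU h₃ c e a Ma da hda (hMa₀ 1) (hMa₁ 1) (hMa₂ 1) (hMa₃ 1)
      (2 * (Var.dim (Var.prod (Var.prod (Var.prod (.cm (c 0)) (.cm (c 1))) (.cm (c 2))) (.cm (c 3))) - 2) + 2 * 2)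
    have hdet : ∀ i, LinearMap.det (BettiUniverse.pull (da i) 1) = Algebra.norm ℚ a := fun i ↦ by
      rw [hda i, BettiUniverse.cmEndAction_ι]
      exact det_eq_norm_of_algHom _ (finrank_H1_realisation h₃ (c i) (e i)) a
    have hdetM : LinearMap.det (BettiUniverse.pull Ma 1) = (Algebra.norm ℚ a) ^ 4 := by
      refine (det_eq_prod_of_coprod₄ _ _ _ _ hΨ (BettiUniverse.pull (da 0) 1) (BettiUniverse.pull (da 1) 1)
        (BettiUniverse.pull (da 2) 1) (BettiUniverse.pull (da 3) 1) (BettiUniverse.pull Ma 1)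
        (hMa₀ 1) (hMa₁ 1) (hMa₂ 1) (hMa₃ 1)).trans ?_
      rw [hdet 0, hdet 1, hdet 2, hdet 3]
      ring
    have hbijMa : Function.Bijective (BettiUniverse.pull Ma 1) := by
      refine (Module.End.isUnit_iff _).mp ((LinearMap.isUnit_iff_isUnit_det _).mpr ?_)
      rw [hdetM]
      exact isUnit_iff_ne_zero.mpr (pow_ne_zero 4 (Algebra.norm_ne_zero_iff.mpr ha))
    exact hii Ma Mb _ hτ hbijMa (hadj a Ma Mb da db hda hMa₀ hMa₁ hMa₂ hMa₃ hdb hMb₀ hMb₁ hMb₂ hMb₃)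


/-- **Row M22 `Fact_algDuality` of the model universe `universeOf hHD hI hU h₃`, modulo the R2 → P input `hR2P`**
(bases `b`, `y` of `H¹(prod4 K Φ; ℚ)`, the Fourier kernel rational algebraic — K-b, b16's
`sum_pull_cupPowOne_cup_mem_ratAlgebraicClasses` verbatim — and the Rosati tensor identity in adjoint form for all
`IsDiagAct` data; `c i := cmCode K (Φ i)`, `e i := cmCodeEquiv K (Φ i)`; `IsDiagAct` destructured as in model-1's
`universeOf_deg_diag`).  When the R2 → P theorem lands, row M22 is DISCHARGED by
`universeOf_fact_algDuality hHD hI hU h₃ ⟨that theorem⟩`. [cite: Lieberman1968, Thm. 1] -/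
theorem universeOf_fact_algDuality (hHD : exists_isReal_hodgeModel) (hI : hodgePQ_independent_of_hodgeModel)
    (hU : BallQuotientUniformisedDatum) (h₃ : CMAbelianVarietyRealised)
    (hR2P : ∀ (K : CMField) (Φ : Fin 4 → CMType K), ∃ (N : ℕ) (b y : Module.Basis (Fin N) ℚ
      (Var.Coh hU h₃ (Var.prod (Var.prod (Var.prod (.cm (cmCode K (Φ 0))) (.cm (cmCode K (Φ 1))))
        (.cm (cmCode K (Φ 2)))) (.cm (cmCode K (Φ 3)))) 1)),
        (∑ cc : Fin 4 → Fin N, bettiCup (two_mul 4).symm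
        (BettiUniverse.pull
            (fst (Var.scheme hU h₃ (Var.prod (Var.prod (Var.prod (.cm (cmCode K (Φ 0))) (.cm (cmCode K (Φ 1)))) (.cm (cmCode K (Φ 2)))) (.cm (cmCode K (Φ 3)))))
              (Var.scheme hU h₃ (Var.prod (Var.prod (Var.prod (.cm (cmCode K (Φ 0))) (.cm (cmCode K (Φ 1)))) (.cm (cmCode K (Φ 2)))) (.cm (cmCode K (Φ 3)))))) 4
          (cupPowOne ℚ (ComplexPoints
            (Var.scheme hU h₃ (Var.prod (Var.prod (Var.prod (.cm (cmCode K (Φ 0))) (.cm (cmCode K (Φ 1)))) (.cm (cmCode K (Φ 2)))) (.cm (cmCode K (Φ 3)))))) 4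
            (fun p ↦ b (cc p))))
        (BettiUniverse.pull
            (snd (Var.scheme hU h₃ (Var.prod (Var.prod (Var.prod (.cm (cmCode K (Φ 0))) (.cm (cmCode K (Φ 1)))) (.cm (cmCode K (Φ 2)))) (.cm (cmCode K (Φ 3)))))
              (Var.scheme hU h₃ (Var.prod (Var.prod (Var.prod (.cm (cmCode K (Φ 0))) (.cm (cmCode K (Φ 1)))) (.cm (cmCode K (Φ 2)))) (.cm (cmCode K (Φ 3)))))) 4
          (cupPowOne ℚ (ComplexPoints
            (Var.scheme hU h₃ (Var.prod (Var.prod (Var.prod (.cm (cmCode K (Φ 0))) (.cm (cmCode K (Φ 1)))) (.cm (cmCode K (Φ 2)))) (.cm (cmCode K (Φ 3)))))) 4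
            (fun p ↦ y (cc p))))) ∈
      ratAlgebraicClasses
        (Var.scheme hU h₃ (Var.prod (Var.prod (Var.prod (.cm (cmCode K (Φ 0))) (.cm (cmCode K (Φ 1)))) (.cm (cmCode K (Φ 2)))) (.cm (cmCode K (Φ 3)))) ⊗
          Var.scheme hU h₃ (Var.prod (Var.prod (Var.prod (.cm (cmCode K (Φ 0))) (.cm (cmCode K (Φ 1)))) (.cm (cmCode K (Φ 2)))) (.cm (cmCode K (Φ 3))))) 4 ∧
        ∀ (a : K)
        (Ma Mb : Var.Mor hU h₃ (Var.prod (Var.prod (Var.prod (.cm (cmCode K (Φ 0))) (.cm (cmCode K (Φ 1)))) (.cm (cmCode K (Φ 2)))) (.cm (cmCode K (Φ 3))))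
          (Var.prod (Var.prod (Var.prod (.cm (cmCode K (Φ 0))) (.cm (cmCode K (Φ 1)))) (.cm (cmCode K (Φ 2)))) (.cm (cmCode K (Φ 3)))))
        (da db : (i : Fin 4) → Var.Mor hU h₃ (.cm (cmCode K (Φ i))) (.cm (cmCode K (Φ i)))),
        (∀ i, BettiUniverse.pull (da i) 1 =
          (BettiUniverse.cmEndAction ((cmRealisation h₃ (cmCode K (Φ i))).θ.comp (cmCodeEquiv K (Φ i)).toRingHom)
            ((cmRealisation h₃ (cmCode K (Φ i))).exists_map_comp (cmCodeEquiv K (Φ i))) hHD hI (Var.isSmoothProjective hU h₃ (.cm (cmCode K (Φ i))))).ι a) →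
        (∀ k, BettiUniverse.pull Ma k ∘ₗ
            BettiUniverse.pull (Var.comp hU h₃ (Var.fst hU h₃ _ (.cm (cmCode K (Φ 3))))
              (Var.comp hU h₃ (Var.fst hU h₃ _ (.cm (cmCode K (Φ 2)))) (Var.fst hU h₃ (.cm (cmCode K (Φ 0))) (.cm (cmCode K (Φ 1)))))) k =
          BettiUniverse.pull (Var.comp hU h₃ (Var.fst hU h₃ _ (.cm (cmCode K (Φ 3))))
              (Var.comp hU h₃ (Var.fst hU h₃ _ (.cm (cmCode K (Φ 2)))) (Var.fst hU h₃ (.cm (cmCode K (Φ 0))) (.cm (cmCode K (Φ 1)))))) k ∘ₗ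
            BettiUniverse.pull (da 0) k) →
        (∀ k, BettiUniverse.pull Ma k ∘ₗ
            BettiUniverse.pull (Var.comp hU h₃ (Var.fst hU h₃ _ (.cm (cmCode K (Φ 3))))
              (Var.comp hU h₃ (Var.fst hU h₃ _ (.cm (cmCode K (Φ 2)))) (Var.snd hU h₃ (.cm (cmCode K (Φ 0))) (.cm (cmCode K (Φ 1)))))) k =
          BettiUniverse.pull (Var.comp hU h₃ (Var.fst hU h₃ _ (.cm (cmCode K (Φ 3))))
              (Var.comp hU h₃ (Var.fst hU h₃ _ (.cm (cmCode K (Φ 2)))) (Var.snd hU h₃ (.cm (cmCode K (Φ 0))) (.cm (cmCode K (Φ 1)))))) k ∘ₗ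
            BettiUniverse.pull (da 1) k) →
        (∀ k, BettiUniverse.pull Ma k ∘ₗ
            BettiUniverse.pull (Var.comp hU h₃ (Var.fst hU h₃ _ (.cm (cmCode K (Φ 3)))) (Var.snd hU h₃ _ (.cm (cmCode K (Φ 2))))) k =
          BettiUniverse.pull (Var.comp hU h₃ (Var.fst hU h₃ _ (.cm (cmCode K (Φ 3)))) (Var.snd hU h₃ _ (.cm (cmCode K (Φ 2))))) k ∘ₗ
            BettiUniverse.pull (da 2) k) →
        (∀ k, BettiUniverse.pull Ma k ∘ₗ BettiUniverse.pull (Var.snd hU h₃ _ (.cm (cmCode K (Φ 3)))) k =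
          BettiUniverse.pull (Var.snd hU h₃ _ (.cm (cmCode K (Φ 3)))) k ∘ₗ BettiUniverse.pull (da 3) k) →
        (∀ i, BettiUniverse.pull (db i) 1 =
          (BettiUniverse.cmEndAction ((cmRealisation h₃ (cmCode K (Φ i))).θ.comp (cmCodeEquiv K (Φ i)).toRingHom)
            ((cmRealisation h₃ (cmCode K (Φ i))).exists_map_comp (cmCodeEquiv K (Φ i))) hHD hI (Var.isSmoothProjective hU h₃ (.cm (cmCode K (Φ i))))).ι
            (cmConjRingHom K a)) →
        (∀ k, BettiUniverse.pull Mb k ∘ₗ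
            BettiUniverse.pull (Var.comp hU h₃ (Var.fst hU h₃ _ (.cm (cmCode K (Φ 3))))
              (Var.comp hU h₃ (Var.fst hU h₃ _ (.cm (cmCode K (Φ 2)))) (Var.fst hU h₃ (.cm (cmCode K (Φ 0))) (.cm (cmCode K (Φ 1)))))) k =
          BettiUniverse.pull (Var.comp hU h₃ (Var.fst hU h₃ _ (.cm (cmCode K (Φ 3))))
              (Var.comp hU h₃ (Var.fst hU h₃ _ (.cm (cmCode K (Φ 2)))) (Var.fst hU h₃ (.cm (cmCode K (Φ 0))) (.cm (cmCode K (Φ 1)))))) k ∘ₗ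
            BettiUniverse.pull (db 0) k) →
        (∀ k, BettiUniverse.pull Mb k ∘ₗ
            BettiUniverse.pull (Var.comp hU h₃ (Var.fst hU h₃ _ (.cm (cmCode K (Φ 3))))
              (Var.comp hU h₃ (Var.fst hU h₃ _ (.cm (cmCode K (Φ 2)))) (Var.snd hU h₃ (.cm (cmCode K (Φ 0))) (.cm (cmCode K (Φ 1)))))) k =
          BettiUniverse.pull (Var.comp hU h₃ (Var.fst hU h₃ _ (.cm (cmCode K (Φ 3))))
              (Var.comp hU h₃ (Var.fst hU h₃ _ (.cm (cmCode K (Φ 2)))) (Var.snd hU h₃ (.cm (cmCode K (Φ 0))) (.cm (cmCode K (Φ 1)))))) k ∘ₗ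
            BettiUniverse.pull (db 1) k) →
        (∀ k, BettiUniverse.pull Mb k ∘ₗ
            BettiUniverse.pull (Var.comp hU h₃ (Var.fst hU h₃ _ (.cm (cmCode K (Φ 3)))) (Var.snd hU h₃ _ (.cm (cmCode K (Φ 2))))) k =
          BettiUniverse.pull (Var.comp hU h₃ (Var.fst hU h₃ _ (.cm (cmCode K (Φ 3)))) (Var.snd hU h₃ _ (.cm (cmCode K (Φ 2))))) k ∘ₗ
            BettiUniverse.pull (db 2) k) →
        (∀ k, BettiUniverse.pull Mb k ∘ₗ BettiUniverse.pull (Var.snd hU h₃ _ (.cm (cmCode K (Φ 3)))) k =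
          BettiUniverse.pull (Var.snd hU h₃ _ (.cm (cmCode K (Φ 3)))) k ∘ₗ BettiUniverse.pull (db 3) k) →
        ∑ a', BettiUniverse.pull Ma 1 (b a') ⊗ₜ[ℚ] y a' = ∑ a', b a' ⊗ₜ[ℚ] BettiUniverse.pull Mb 1 (y a')) :
    (universeOf hHD hI hU h₃).Fact_algDuality := by
  intro K Φ
  obtain ⟨N, b, y, halg, hadj⟩ := hR2P K Φ
  obtain ⟨D, hbij, hmap, hii⟩ := var_algDuality_adjoint hHD hI hU h₃ (fun i ↦ cmCode K (Φ i))
    (fun i ↦ cmCodeEquiv K (Φ i)) b y halg hadj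
  refine ⟨D, hbij, hmap, ?_⟩
  rintro a Ma Mb ⟨da, hda, hMa⟩ ⟨db, hdb, hMb⟩
  exact hii a Ma Mb da db hda (hMa 0) (hMa 1) (hMa 2) (hMa 3) hdb (hMb 0) (hMb 1) (hMb 2) (hMb 3)

end Summit.HodgeConjecture.CorCM.Model

end
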